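import Summits.CriticalPhenomena.PercolationContinuityZ3.Theorems.PercNearOneGluingAdditiveGluingFibreCriterion
import HarnessLib

/-!
# The TWO-REPLICA FIBRE CRITERION and its instance for the halving lemma (v) (Sahi programme, prover prim-sahi-p2 gen 43)

Support file (`--supports stmt-CriticalPhenomena-4575`, helper).  No named facts, no sorries; the only definitions are bookkeeping
abbreviations (weights / counts / signed fibre sums), as in the three-replica companion
`…PercNearOneGluingAdditiveGluingFibreCriterion` (whose `wt`, `cfg`, `prodBernoulli_real_eq_sum_bool` are reused).
Memo `run/shared/lean/prim/prim-sahi/FROM-prim-sahi-p2-gen43-TRANSPLANT-REDUCTION.md`; `prim-sahi-p2/PROOF-E3.md` §52 (52c), §53.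

A product of TWO `prodBernoulli p` probabilities is a sum over PAIRS of configurations ("two replicas") weighted by the tensor
Bernstein monomial `∏_e p_e^{I e}(1-p_e)^{2-I e}` of their count vector `I e = #{replicas in which e is open} ∈ {0,1,2}`
(`real_mul_real_eq_sum2`).  Hence (`quadratic2_nonneg_of_fibres`) a signed combination of two such products is `≥ 0` for ALL
weights as soon as every signed FIBRE SUM (the signed number of replica pairs with a given count vector) is `≥ 0` — a weight-free
finite statement per graph; the pairs with count vector `I` are exactly the complementary pairs `(K ∪ X, K ∪ (P ∖ X))`, `X ⊆ P`,
`K = {I = 2}`, `P = {I = 1}` (the "p = ½ complementary coupling" of the memos of gens 42–43).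

INSTANCE (`halving_of_fibres`): the three-point HALVING LEMMA (v) `μ(U)·μ(D) ≤ 2·μ(U ∩ D)` (`U = {a↔s} ∪ {a↔c}`, `D = {s↮c}`) holds on
`(V; s, a, c)` for EVERY weight vector as soon as `fibreSumV s a c I ≥ 0` for every count vector `I`, i.e. as soon as in every
complementary coupling `#{X : K∪X ∈ U, K∪(P∖X) ∈ D} ≤ 2·#{X : K∪X ∈ U ∩ D}` ((v½ᶜ) of the memo; verified by exhaustive counting on
`K₄ … K₇` by the census lane, §187, and reduced to the doubly-blocked residue in PROOF-E3 §53 — NOT proved in general; nothing here asserts it).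
[folklore] (Bernstein expansion of a multi-affine product; replica / fibre bookkeeping as in Reimer's proof of the van den Berg–Kesten conjecture)
-/

namespace Summit.CriticalPhenomena.PercolationContinuityZ3.Theorems

namespace HalvingFibre

open MeasureTheory Set Finset Literature.Probability.Percolation
open Literature.Probability.LatticeModels (prodBernoulli)
open Summit.CriticalPhenomena.PercolationContinuityZ3.Cruxes.AdditiveGluing.TieLine.FibreCount (wt cfg wt_nonneg prodBernoulli_real_eq_sum_bool)
open Classical

section Criterion

variable {ι : Type*} [Fintype ι]

/-- Number of `true`s among two Booleans (the count of one coordinate over two replicas). [folklore] -/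
def cnt2 (x y : Bool) : ℕ := x.toNat + y.toNat

/-- A pair of configurations ("two replicas"). [folklore] -/
abbrev Pair (ι : Type*) := (ι → Bool) × (ι → Bool)

/-- The count vector of a replica pair: `cnt t i ∈ {0,1,2}`. [folklore] -/
def cnt (t : Pair ι) : ι → ℕ := fun i => cnt2 (t.1 i) (t.2 i)

/-- The two-replica fibre weight of a count vector: `∏_i p_i^{I i} (1 - p_i)^{2 - I i}`. [folklore] -/
noncomputable def fibWt2 (p : ι → unitInterval) (I : ι → ℕ) : ℝ := ∏ i, ((p i : unitInterval) : ℝ) ^ I i * (1 - ((p i : unitInterval) : ℝ)) ^ (2 - I i)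

/-- The fibre weight is nonnegative. [folklore] -/
theorem fibWt2_nonneg (p : ι → unitInterval) (I : ι → ℕ) : 0 ≤ fibWt2 p I :=
  Finset.prod_nonneg fun i _ => mul_nonneg (pow_nonneg (p i).2.1 _) (pow_nonneg (sub_nonneg.2 (p i).2.2) _)

omit [Fintype ι] in
/-- The product of the two coordinate weights of a replica pair is the Bernstein monomial of its count. [folklore] -/
theorem wt_mul_wt (p : ι → unitInterval) (i : ι) (x y : Bool) :
    wt p i x * wt p i y = ((p i : unitInterval) : ℝ) ^ cnt2 x y * (1 - ((p i : unitInterval) : ℝ)) ^ (2 - cnt2 x y) := by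
  cases x <;> cases y <;>
    simp only [wt, cnt2, Bool.toNat_true, Bool.toNat_false, Bool.false_eq_true, if_true, if_false] <;> ring

/-- Indicator (as a real number) that the two configurations of a replica pair lie in two prescribed events. [folklore] -/
noncomputable def ind2 (A B : Set (Set ι)) (t : Pair ι) : ℝ := if cfg t.1 ∈ A ∧ cfg t.2 ∈ B then 1 else 0

/-- **Two replicas.**  A product of two probabilities is a sum over replica pairs weighted by the fibre weight of their count vector.
[folklore] -/
theorem real_mul_real_eq_sum2 (p : ι → unitInterval) (A B : Set (Set ι)) :
    (prodBernoulli p).real A * (prodBernoulli p).real B = ∑ t : Pair ι, fibWt2 p (cnt t) * ind2 A B t := by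
  have hR : ∑ t : Pair ι, fibWt2 p (cnt t) * ind2 A B t =
      ∑ a : ι → Bool, ∑ b : ι → Bool, fibWt2 p (cnt (a, b)) * ind2 A B (a, b) := by
    simp only [Fintype.sum_prod_type]
  rw [hR, prodBernoulli_real_eq_sum_bool p A, prodBernoulli_real_eq_sum_bool p B, Finset.sum_mul_sum]
  refine Finset.sum_congr rfl fun a _ => ?_
  refine Finset.sum_congr rfl fun b _ => ?_
  unfold ind2
  by_cases ha : cfg a ∈ A <;> by_cases hb : cfg b ∈ B <;>
    simp only [ha, hb, if_true, if_false, and_true, and_false, and_self, mul_zero, zero_mul, mul_one]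
  rw [← Finset.prod_mul_distrib]
  unfold fibWt2 cnt
  exact Finset.prod_congr rfl fun i _ => wt_mul_wt p i (a i) (b i)

/-- The signed fibre sum of a two-term quadratic combination at the count vector `I`. [folklore] -/
noncomputable def fibreSum2 (s₀ s₁ : ℝ) (A₀ A₁ B₀ B₁ : Set (Set ι)) (I : ι → ℕ) : ℝ :=
  ∑ t ∈ (Finset.univ : Finset (Pair ι)).filter (fun t => cnt t = I), (s₀ * ind2 A₀ A₁ t + s₁ * ind2 B₀ B₁ t)

/-- **The two-replica fibre criterion (two quadratic terms).**  If every signed fibre sum is nonnegative, then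
`s₀·μ(A₀)μ(A₁) + s₁·μ(B₀)μ(B₁) ≥ 0` for EVERY weight vector. [folklore] -/
theorem quadratic2_nonneg_of_fibres (p : ι → unitInterval) (s₀ s₁ : ℝ) (A₀ A₁ B₀ B₁ : Set (Set ι))
    (h : ∀ I : ι → ℕ, 0 ≤ fibreSum2 s₀ s₁ A₀ A₁ B₀ B₁ I) :
    0 ≤ s₀ * ((prodBernoulli p).real A₀ * (prodBernoulli p).real A₁) + s₁ * ((prodBernoulli p).real B₀ * (prodBernoulli p).real B₁) := by
  rw [real_mul_real_eq_sum2 p A₀ A₁, real_mul_real_eq_sum2 p B₀ B₁, Finset.mul_sum, Finset.mul_sum, ← Finset.sum_add_distrib]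
  have hterm : ∀ t : Pair ι,
      s₀ * (fibWt2 p (cnt t) * ind2 A₀ A₁ t) + s₁ * (fibWt2 p (cnt t) * ind2 B₀ B₁ t) =
        fibWt2 p (cnt t) * (s₀ * ind2 A₀ A₁ t + s₁ * ind2 B₀ B₁ t) := by
    intro t; ring
  simp_rw [hterm]
  rw [← Finset.sum_fiberwise_of_maps_to (s := (Finset.univ : Finset (Pair ι))) (t := Finset.univ.image cnt) (g := cnt)
    (fun t ht => Finset.mem_image_of_mem cnt ht)]
  refine Finset.sum_nonneg fun I _ => ?_
  have hI : ∑ t ∈ (Finset.univ : Finset (Pair ι)).filter (fun t => cnt t = I),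
      fibWt2 p (cnt t) * (s₀ * ind2 A₀ A₁ t + s₁ * ind2 B₀ B₁ t) = fibWt2 p I * fibreSum2 s₀ s₁ A₀ A₁ B₀ B₁ I := by
    unfold fibreSum2
    rw [Finset.mul_sum]
    refine Finset.sum_congr rfl fun t ht => ?_
    rw [(Finset.mem_filter.1 ht).2]
  rw [hI]
  exact mul_nonneg (fibWt2_nonneg p I) (h I)

end Criterion

/-! ### The instance for the halving lemma (v) -/

section Halving

variable {V : Type*} [Fintype V]

/-- The signed two-replica fibre sum of (v) at a count vector `I` (weight-free): the terms are `+2·(U∩D)·Ω` and `−U·D` with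
`U = {a↔s} ∪ {a↔c}`, `D = {s↮c}`; `fibreSumV s a c I` is the signed number of replica pairs with count vector `I` realising them,
i.e. `2·#{X ⊆ P : K∪X ∈ U∩D} − #{X ⊆ P : K∪X ∈ U, K∪(P∖X) ∈ D}` for `K = {I = 2}`, `P = {I = 1}` (and `0` if some `I e > 2`).
((v½ᶜ) of the memo asserts it is always `≥ 0`; verified on `K₄ … K₇`, not proved.) [this work] -/
noncomputable def fibreSumV (s a c : V) (I : Sym2 V → ℕ) : ℝ :=
  fibreSum2 2 (-1)
    (((openConn s a ∪ openConn c a) ∩ (openConn s c)ᶜ : Set (BondConfig V))) (Set.univ : Set (BondConfig V))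
    ((openConn s a ∪ openConn c a : Set (BondConfig V))) ((openConn s c)ᶜ : Set (BondConfig V)) I

/-- **(v) FROM ITS FIBRE COUNTS.**  For fixed `(V; s, a, c)`: if every signed fibre sum `fibreSumV s a c I` is nonnegative, then the
halving lemma (v) `μ(U)·μ(D) ≤ 2·μ(U ∩ D)` holds for EVERY weight vector `w` on the pairs of `V`. [this work] -/
theorem halving_of_fibres (w : Sym2 V → unitInterval) (s a c : V) (h : ∀ I : Sym2 V → ℕ, 0 ≤ fibreSumV s a c I) :
    (prodBernoulli w).real (openConn s a ∪ openConn c a : Set (BondConfig V)) *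
        (prodBernoulli w).real ((openConn s c)ᶜ : Set (BondConfig V)) ≤
      2 * (prodBernoulli w).real ((openConn s a ∪ openConn c a) ∩ (openConn s c)ᶜ : Set (BondConfig V)) := by
  have key := quadratic2_nonneg_of_fibres (ι := Sym2 V) w 2 (-1)
    (((openConn s a ∪ openConn c a) ∩ (openConn s c)ᶜ : Set (BondConfig V))) (Set.univ : Set (BondConfig V))
    ((openConn s a ∪ openConn c a : Set (BondConfig V))) ((openConn s c)ᶜ : Set (BondConfig V)) h
  have huniv : (prodBernoulli w).real (Set.univ : Set (BondConfig V)) = 1 := probReal_univ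
  rw [huniv] at key
  nlinarith [key]

end Halving

/-! ### The sharp instance (prover prim-sahi-p2 gen 44): `2·bad ≤ 3·good` per fibre ⟹ `2·μ(U)μ(D) ≤ 3·μ(U ∩ D)`

Gen 44 (memo `FROM-prim-sahi-p2-gen44-TELESCOPING.md`, PROOF-E3 §54) conjectures the SHARP fibre inequality `2·bad ≤ 3·good`
(equality on the path `s–a–c` and on the hub fibre `H₂ = K_{2,3}`; 0 violations in ≈ 6 600 exhaustively enumerated random
multigraphs with `n ≤ 10`, `m ≤ 18` and on every fibre of `K₄, K₅, K₆`).  Nothing below asserts it: `halving_sharp_of_fibres` is the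
typed landing pad (fibre counts ⟹ law-level `2·μ(U)·μ(D) ≤ 3·μ(U∩D)` for all weights) and `fibreSumV_nonneg_of_sharp` records that the
sharp fibre counts imply the fibre counts of `halving_of_fibres`. -/

section HalvingSharp

variable {ι : Type*} [Fintype ι]

/-- The (real) number of replica pairs with count vector `I` whose replicas lie in `A` resp. `B`. [folklore] -/
noncomputable def pairCount (A B : Set (Set ι)) (I : ι → ℕ) : ℝ :=
  ∑ t ∈ (Finset.univ : Finset (Pair ι)).filter (fun t => cnt t = I), ind2 A B t

omit [Fintype ι] in
/-- The pair indicator is nonnegative. [folklore] -/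
theorem ind2_nonneg (A B : Set (Set ι)) (t : Pair ι) : 0 ≤ ind2 A B t := by
  unfold ind2; split_ifs <;> norm_num

/-- Pair counts are nonnegative. [folklore] -/
theorem pairCount_nonneg (A B : Set (Set ι)) (I : ι → ℕ) : 0 ≤ pairCount A B I :=
  Finset.sum_nonneg fun t _ => ind2_nonneg A B t

/-- A signed fibre sum is the corresponding signed combination of the two pair counts. [folklore] -/
theorem fibreSum2_eq_pairCount (s₀ s₁ : ℝ) (A₀ A₁ B₀ B₁ : Set (Set ι)) (I : ι → ℕ) :
    fibreSum2 s₀ s₁ A₀ A₁ B₀ B₁ I = s₀ * pairCount A₀ A₁ I + s₁ * pairCount B₀ B₁ I := by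
  unfold fibreSum2 pairCount
  rw [Finset.sum_add_distrib, Finset.mul_sum, Finset.mul_sum]

variable {V : Type*} [Fintype V]

/-- The signed two-replica fibre sum of the SHARP form at a count vector `I`: terms `+3·(U∩D)·Ω` and `−2·U·D`
(`U = {a↔s} ∪ {a↔c}`, `D = {s↮c}`), i.e. `3·#{X ⊆ P : K∪X ∈ U∩D} − 2·#{X ⊆ P : K∪X ∈ U, K∪(P∖X) ∈ D}` for `K = {I = 2}`,
`P = {I = 1}`.  (Gen 44's sharp conjecture asserts it is always `≥ 0`; NOT proved.) [this work] -/
noncomputable def fibreSumV32 (s a c : V) (I : Sym2 V → ℕ) : ℝ :=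
  fibreSum2 3 (-2)
    (((openConn s a ∪ openConn c a) ∩ (openConn s c)ᶜ : Set (BondConfig V))) (Set.univ : Set (BondConfig V))
    ((openConn s a ∪ openConn c a : Set (BondConfig V))) ((openConn s c)ᶜ : Set (BondConfig V)) I

/-- The sharp fibre counts imply the fibre counts of (v): `3G − 2B ≥ 0 ⟹ 2G − B ≥ 0` since `G ≥ 0`. [this work] -/
theorem fibreSumV_nonneg_of_sharp (s a c : V) (I : Sym2 V → ℕ) (h : 0 ≤ fibreSumV32 s a c I) : 0 ≤ fibreSumV s a c I := by
  unfold fibreSumV32 at h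
  unfold fibreSumV
  rw [fibreSum2_eq_pairCount] at h ⊢
  have hG := pairCount_nonneg (((openConn s a ∪ openConn c a) ∩ (openConn s c)ᶜ : Set (BondConfig V)))
    (Set.univ : Set (BondConfig V)) I
  linarith

/-- **(v♯) FROM ITS FIBRE COUNTS.**  For fixed `(V; s, a, c)`: if every sharp fibre sum `fibreSumV32 s a c I` is nonnegative, then
`2·μ(U)·μ(D) ≤ 3·μ(U ∩ D)` holds for EVERY weight vector `w` on the pairs of `V` (law shadow: `T·p₀ ≤ (½ + p₃)(p₁ + p₂)`). [this work] -/
theorem halving_sharp_of_fibres (w : Sym2 V → unitInterval) (s a c : V) (h : ∀ I : Sym2 V → ℕ, 0 ≤ fibreSumV32 s a c I) :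
    2 * ((prodBernoulli w).real (openConn s a ∪ openConn c a : Set (BondConfig V)) *
        (prodBernoulli w).real ((openConn s c)ᶜ : Set (BondConfig V))) ≤
      3 * (prodBernoulli w).real ((openConn s a ∪ openConn c a) ∩ (openConn s c)ᶜ : Set (BondConfig V)) := by
  have key := quadratic2_nonneg_of_fibres (ι := Sym2 V) w 3 (-2)
    (((openConn s a ∪ openConn c a) ∩ (openConn s c)ᶜ : Set (BondConfig V))) (Set.univ : Set (BondConfig V))
    ((openConn s a ∪ openConn c a : Set (BondConfig V))) ((openConn s c)ᶜ : Set (BondConfig V)) h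
  have huniv : (prodBernoulli w).real (Set.univ : Set (BondConfig V)) = 1 := probReal_univ
  rw [huniv] at key
  nlinarith [key]

/-- The sharp fibre counts also give (v) itself, for every weight vector. [this work] -/
theorem halving_of_sharp_fibres (w : Sym2 V → unitInterval) (s a c : V) (h : ∀ I : Sym2 V → ℕ, 0 ≤ fibreSumV32 s a c I) :
    (prodBernoulli w).real (openConn s a ∪ openConn c a : Set (BondConfig V)) *
        (prodBernoulli w).real ((openConn s c)ᶜ : Set (BondConfig V)) ≤
      2 * (prodBernoulli w).real ((openConn s a ∪ openConn c a) ∩ (openConn s c)ᶜ : Set (BondConfig V)) :=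
  halving_of_fibres w s a c fun I => fibreSumV_nonneg_of_sharp s a c I (h I)

end HalvingSharp

/-! ### The identity ★ of gen 44 at fibre level: `bad − good = R − X₁⁺` (per count vector)

For every count vector `I` (and in fact for every set of replica pairs closed under the swap `(ω₁,ω₂) ↦ (ω₂,ω₁)`):
`#{U·D pairs} − #{(U∩D)·Ω pairs} = #{J·Z₀ pairs} − #{X₁·SC pairs}` with `J = U ∩ Dᶜ`, `Z₀ = D ∩ Uᶜ`, `SC = Uᶜ ∩ Dᶜ`,
`X₁ = U ∩ D` — the two-replica form of `P(U)P(D) − P(U∩D) = P(J)P(Z₀) − P(X₁)P(SC)` and of the complementary-coupling identity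
`bad − good = |R| − |X₁⁺|` (memo `FROM-prim-sahi-p2-gen44-TELESCOPING.md` §2; gen 43's transplant target `|R| ≤ |X₁| + |X₁⁺|`).
Proof: symmetrise over the swap and check a polynomial identity in four Booleans.  Consequence (`halving_of_transplant_counts`):
(v) holds for all weights as soon as `#{J·Z₀} ≤ #{X₁·Ω} + #{X₁·SC}` in every fibre. -/

section IdentityStar

variable {ι : Type*} [Fintype ι]

/-- Swapping the two replicas. [folklore] -/
def Pair.swap (t : Pair ι) : Pair ι := (t.2, t.1)

omit [Fintype ι] in
/-- The swap is an involution. [folklore] -/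
theorem Pair.swap_swap (t : Pair ι) : Pair.swap (Pair.swap t) = t := rfl

omit [Fintype ι] in
/-- The count vector is swap-invariant. [folklore] -/
theorem cnt_swap (t : Pair ι) : cnt (Pair.swap t) = cnt t := by
  funext i
  unfold cnt cnt2 Pair.swap
  exact Nat.add_comm _ _

/-- The swap as an equivalence of `Pair ι`. [folklore] -/
def swapEquiv : Pair ι ≃ Pair ι where
  toFun := Pair.swap
  invFun := Pair.swap
  left_inv := Pair.swap_swap
  right_inv := Pair.swap_swap

/-- A sum over a fibre is invariant under swapping the replicas in the summand. [folklore] -/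
theorem sum_fibre_swap (I : ι → ℕ) (f : Pair ι → ℝ) :
    ∑ t ∈ (Finset.univ : Finset (Pair ι)).filter (fun t => cnt t = I), f (Pair.swap t) =
      ∑ t ∈ (Finset.univ : Finset (Pair ι)).filter (fun t => cnt t = I), f t := by
  refine Finset.sum_equiv (swapEquiv (ι := ι)) (fun t => ?_) (fun t _ => rfl)
  simp only [Finset.mem_filter, Finset.mem_univ, true_and]
  show cnt t = I ↔ cnt (Pair.swap t) = I
  rw [cnt_swap]

omit [Fintype ι] in
/-- The four-Boolean identity behind ★: for a swap-symmetrised pair, `UD + DU − (U∩D)Ω − Ω(U∩D) = JZ₀ + Z₀J − X₁SC − SC·X₁`.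
[this work] -/
theorem ind2_star_pointwise (U D : Set (Set ι)) (t : Pair ι) :
    (ind2 U D t + ind2 U D (Pair.swap t)) - (ind2 (U ∩ D) Set.univ t + ind2 (U ∩ D) Set.univ (Pair.swap t)) =
      (ind2 (U ∩ Dᶜ) (D ∩ Uᶜ) t + ind2 (U ∩ Dᶜ) (D ∩ Uᶜ) (Pair.swap t)) -
        (ind2 (U ∩ D) (Uᶜ ∩ Dᶜ) t + ind2 (U ∩ D) (Uᶜ ∩ Dᶜ) (Pair.swap t)) := by
  unfold ind2 Pair.swap
  simp only [Set.mem_inter_iff, Set.mem_compl_iff, Set.mem_univ, and_true]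
  by_cases h1 : cfg t.1 ∈ U <;> by_cases h2 : cfg t.1 ∈ D <;> by_cases h3 : cfg t.2 ∈ U <;> by_cases h4 : cfg t.2 ∈ D <;>
    simp [h1, h2, h3, h4]

/-- **Identity ★ per fibre.**  `#{U·D} − #{(U∩D)·Ω} = #{J·Z₀} − #{X₁·SC}` in every fibre. [this work] -/
theorem pairCount_star (U D : Set (Set ι)) (I : ι → ℕ) :
    pairCount U D I - pairCount (U ∩ D) Set.univ I =
      pairCount (U ∩ Dᶜ) (D ∩ Uᶜ) I - pairCount (U ∩ D) (Uᶜ ∩ Dᶜ) I := by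
  have key : ∀ (A B : Set (Set ι)), 2 * pairCount A B I =
      ∑ t ∈ (Finset.univ : Finset (Pair ι)).filter (fun t => cnt t = I), (ind2 A B t + ind2 A B (Pair.swap t)) := by
    intro A B
    unfold pairCount
    rw [Finset.sum_add_distrib, sum_fibre_swap I (ind2 A B), two_mul]
  have h2 : 2 * (pairCount U D I - pairCount (U ∩ D) Set.univ I) =
      2 * (pairCount (U ∩ Dᶜ) (D ∩ Uᶜ) I - pairCount (U ∩ D) (Uᶜ ∩ Dᶜ) I) := by
    rw [mul_sub, mul_sub, key, key, key, key, ← Finset.sum_sub_distrib, ← Finset.sum_sub_distrib]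
    exact Finset.sum_congr rfl fun t _ => ind2_star_pointwise U D t
  linarith

variable {V : Type*} [Fintype V]

/-- **The fibre sum of (v) in R/X₁⁺ form:** `fibreSumV = #{X₁·Ω} − #{J·Z₀} + #{X₁·SC}` with `J = {s,a,c all joined}`,
`Z₀ = {s,a,c pairwise separated}`, `SC = {s ~ c, a separated}` (as `U ∩ Dᶜ`, `D ∩ Uᶜ`, `Uᶜ ∩ Dᶜ`). [this work] -/
theorem fibreSumV_eq_transplant_form (s a c : V) (I : Sym2 V → ℕ) :
    fibreSumV s a c I =
      pairCount ((openConn s a ∪ openConn c a) ∩ (openConn s c)ᶜ : Set (BondConfig V)) Set.univ I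
        - pairCount ((openConn s a ∪ openConn c a) ∩ ((openConn s c)ᶜ)ᶜ : Set (BondConfig V))
            ((openConn s c)ᶜ ∩ (openConn s a ∪ openConn c a)ᶜ) I
        + pairCount ((openConn s a ∪ openConn c a) ∩ (openConn s c)ᶜ : Set (BondConfig V))
            ((openConn s a ∪ openConn c a)ᶜ ∩ ((openConn s c)ᶜ)ᶜ) I := by
  unfold fibreSumV
  rw [fibreSum2_eq_pairCount]
  have h := pairCount_star ((openConn s a ∪ openConn c a : Set (BondConfig V))) ((openConn s c)ᶜ : Set (BondConfig V)) I
  linarith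

/-- **(v) FROM THE TRANSPLANT COUNTS.**  If in every fibre `#{J·Z₀ pairs} ≤ #{X₁·Ω pairs} + #{X₁·SC pairs}` (gen 43's target
`|R| ≤ |X₁| + |X₁⁺|` in every complementary coupling of every minor), then (v) `μ(U)·μ(D) ≤ 2·μ(U ∩ D)` holds for every weight vector.
[this work] -/
theorem halving_of_transplant_counts (w : Sym2 V → unitInterval) (s a c : V)
    (h : ∀ I : Sym2 V → ℕ,
      pairCount ((openConn s a ∪ openConn c a) ∩ ((openConn s c)ᶜ)ᶜ : Set (BondConfig V))
          ((openConn s c)ᶜ ∩ (openConn s a ∪ openConn c a)ᶜ) I ≤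
        pairCount ((openConn s a ∪ openConn c a) ∩ (openConn s c)ᶜ : Set (BondConfig V)) Set.univ I +
          pairCount ((openConn s a ∪ openConn c a) ∩ (openConn s c)ᶜ : Set (BondConfig V))
            ((openConn s a ∪ openConn c a)ᶜ ∩ ((openConn s c)ᶜ)ᶜ) I) :
    (prodBernoulli w).real (openConn s a ∪ openConn c a : Set (BondConfig V)) *
        (prodBernoulli w).real ((openConn s c)ᶜ : Set (BondConfig V)) ≤
      2 * (prodBernoulli w).real ((openConn s a ∪ openConn c a) ∩ (openConn s c)ᶜ : Set (BondConfig V)) := by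
  refine halving_of_fibres w s a c fun I => ?_
  rw [fibreSumV_eq_transplant_form]
  have := h I
  linarith

end IdentityStar

end HalvingFibre

end Summit.CriticalPhenomena.PercolationContinuityZ3.Theorems
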